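import Summits.QuantumFields.YangMills.Theorems.ColdStartUniversalityLatticeLangevinMarkovProperty
import HarnessLib

/-!
# Route `ColdStartUniversality` (fixed-cut-off SZZ dynamics): consequences of the Markov property of strong solutions —
# ★★★ conditional expectations, the JOINT LAW `κ_s(x,·) ⊗ₘ κ_t` of `(U_s, U_(s+t))`, two-time expectations through the kernels

Helper file (seat `ym-line-csu-p1`, g33; `--supports stmt-QuantumFields-24809`).  From `integral_mul_comp_add_eq_integral_mul_transition` (file 44:
`∫ Z·G(U_(s+t)) dP = ∫ Z·(κ_t G)(U_s) dP` for `𝓕^W_s`-measurable bounded `Z`), for EVERY strong solution `U` of the SU(2) SZZ dynamics from a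
deterministic start `x` on ANY probability space and every Markov kernel family `κ` realising the transition laws:
* ★★★ `condExp_comp_add_ae_eq_transition` — `E[G(U_(s+t)) | σ(W_u : u ≤ s)] = (κ_t G)(U_s)` a.s. (the Markov property in its textbook form);
* ★★★ `map_pair_eq_compProd` — the joint law of `(U_s, U_(s+t))` is `κ_s(x,·) ⊗ₘ κ_t` (uniqueness of finite measures on the product π-system);
* ★★★ `integral_pair_eq_integral_transition` / `integral_pair_eq_integral_integral_transition` — `∫ H(U_s, U_(s+t)) dP = ∫∫ H(y,z) κ_t(y,dz) κ_s(x,dy)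
  = ∫ (∫ H(U_s, z) κ_t(U_s,dz)) dP` for every bounded measurable `H` on `SU(2)^E × SU(2)^E`;
* ★ `integral_mul_comp_add_eq_transition` — `E[F(U_s)·G(U_(s+t))] = ∫ F·(κ_t G) dκ_s(x)` (the two-time correlation function through the semigroup:
  the SOLUTION form the kernel-form space-time statements of the Lieb–Robinson package were stated for);
* `integral_mul_comp_add_eq_integral_mul_markovTransition` — the same with the transition operator written as `markovTransition V P₂ t G` along ANY
  jointly measurable solution family `V` on any other space (LINE 3 vocabulary, cf. `integral_add_eq_integral_markovTransition`).
THEOREMS ONLY, no definition, no sorry; [folklore] / Revuz–Yor-type statements.  HONEST FRAMING: fixed cut-off; structural plumbing;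
`UniformColdStartMixing` (24809) is NOT restated; no crux, rung or summit statement is proved; the Yang–Mills mass gap is NOT proved.
-/

set_option autoImplicit false

noncomputable section

namespace Summit.QuantumFields.YangMills.Theorems.ColdStartUniversality

open MeasureTheory ProbabilityTheory Filter Topology Set
open scoped NNReal ENNReal BigOperators
open Literature Literature.Probability.Process Literature.MathematicalPhysics.QuantumFieldTheory
open Literature.MathematicalPhysics.QuantumLattice (fundamentalRep fundamentalLatticeRep continuous_fundamentalRep)

variable {L : ℕ} [NeZero L]

/-! ## §1. Conditional expectations -/

/-- ★★★ **The Markov property in conditional-expectation form**: `E[G(U_(s+t)) | σ(W_u : u ≤ s)] = (κ_t G)(U_s)` almost surely, for every strong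
solution from a deterministic start on any space and every bounded measurable `G`. [cite: RevuzYor1999, Ch. IX Thm (1.7)] -/
theorem condExp_comp_add_ae_eq_transition (β' : ℝ)
    (κ : ℝ≥0 → Kernel (GaugeConfig 3 L (Matrix.specialUnitaryGroup (Fin 2) ℂ))
      (GaugeConfig 3 L (Matrix.specialUnitaryGroup (Fin 2) ℂ))) [∀ t, IsMarkovKernel (κ t)]
    (hreal : ∀ (t : ℝ≥0) (x : GaugeConfig 3 L (Matrix.specialUnitaryGroup (Fin 2) ℂ))
        (Ω : Type) [MeasurableSpace Ω] (P : Measure Ω) [IsProbabilityMeasure P]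
        (W : ℝ≥0 → Ω → (Edge 3 L × NoiseIdx 2 → ℝ)) (hW : IsFlatBrownian W P)
        (U : ℝ≥0 → Ω → GaugeConfig 3 L (Matrix.specialUnitaryGroup (Fin 2) ℂ)),
        (∀ ω, U 0 ω = x) →
        (latticeLangevinDynamics (fundamentalLatticeRep 2) β').IsSolution (fundamentalRep (Fin 2))
          hW.natFiltration P W U →
        κ t x = P.map (U t))
    (x : GaugeConfig 3 L (Matrix.specialUnitaryGroup (Fin 2) ℂ))
    {Ω : Type} [MeasurableSpace Ω] {P : Measure Ω} [IsProbabilityMeasure P]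
    {W : ℝ≥0 → Ω → (Edge 3 L × NoiseIdx 2 → ℝ)} (hW : IsFlatBrownian W P)
    {U : ℝ≥0 → Ω → GaugeConfig 3 L (Matrix.specialUnitaryGroup (Fin 2) ℂ)} (hU0 : ∀ ω, U 0 ω = x)
    (hU : (latticeLangevinDynamics (fundamentalLatticeRep 2) β').IsSolution (fundamentalRep (Fin 2)) hW.natFiltration P W U)
    (s t : ℝ≥0) {G : GaugeConfig 3 L (Matrix.specialUnitaryGroup (Fin 2) ℂ) → ℝ} (hG : Measurable G) {CG : ℝ} (hGb : ∀ z, |G z| ≤ CG) :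
    P[fun ω => G (U (s + t) ω) | hW.natFiltration s] =ᵐ[P] fun ω => ∫ z, G z ∂(κ t (U s ω)) := by
  have hm : hW.natFiltration s ≤ ‹MeasurableSpace Ω› := hW.natFiltration.le s
  have hmU : ∀ u : ℝ≥0, Measurable (U u) := fun u => (hU.adapted u).mono (hW.natFiltration.le u) le_rfl
  have hκGm : Measurable fun y => ∫ z, G z ∂(κ t y) := (hG.stronglyMeasurable.integral_kernel (κ := κ t)).measurable
  have hκGb : ∀ y, |∫ z, G z ∂(κ t y)| ≤ CG := fun y => by
    have h := norm_integral_le_of_norm_le_const (μ := κ t y) (f := G) (C := CG)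
      (Eventually.of_forall fun z => by simpa [Real.norm_eq_abs] using hGb z)
    simpa [Real.norm_eq_abs] using h
  have hintG : Integrable (fun ω => G (U (s + t) ω)) P :=
    (integrable_const CG).mono' (hG.comp (hmU _)).aestronglyMeasurable
      (Eventually.of_forall fun ω => by simpa [Real.norm_eq_abs] using hGb (U (s + t) ω))
  have hintκ : Integrable (fun ω => ∫ z, G z ∂(κ t (U s ω))) P :=
    (integrable_const CG).mono' (hκGm.comp (hmU s)).aestronglyMeasurable
      (Eventually.of_forall fun ω => by simpa [Real.norm_eq_abs] using hκGb (U s ω))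
  have hgm : Measurable[hW.natFiltration s] fun ω => ∫ z, G z ∂(κ t (U s ω)) := hκGm.comp (hU.adapted s)
  refine (ae_eq_condExp_of_forall_setIntegral_eq hm hintG (fun A _ _ => hintκ.integrableOn) (fun A hA _ => ?_)
    (stronglyMeasurable_real_of_measurable hgm).aestronglyMeasurable).symm
  -- `∫_A (κ_t G)(U_s) dP = ∫_A G(U_(s+t)) dP` is the Markov property with `Z = 1_A`
  have hA0 : MeasurableSet A := hm A hA
  have hZ : Measurable[hW.natFiltration s] (A.indicator fun _ => (1 : ℝ)) := measurable_const.indicator hA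
  have hZb : ∀ ω, |A.indicator (fun _ => (1 : ℝ)) ω| ≤ 1 := fun ω => by by_cases h : ω ∈ A <;> simp [h]
  have hM := integral_mul_comp_add_eq_integral_mul_transition β' κ hreal x hW hU0 hU s t hZ hZb hG hGb
  have hind : ∀ (f : Ω → ℝ), A.indicator f = fun ω => A.indicator (fun _ => (1 : ℝ)) ω * f ω := fun f => by
    funext ω; by_cases h : ω ∈ A <;> simp [h]
  rw [← integral_indicator hA0, ← integral_indicator hA0, hind (fun ω => ∫ z, G z ∂(κ t (U s ω))), hind (fun ω => G (U (s + t) ω))]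
  exact hM.symm

/-! ## §2. The joint law of `(U_s, U_(s+t))` -/

/-- ★★★ **The joint law of `(U_s, U_(s+t))` is `κ_s(x,·) ⊗ₘ κ_t`** for every strong solution from the deterministic start `x` on any space.
[cite: RevuzYor1999, Ch. III Prop. (1.4)–(1.5)] -/
theorem map_pair_eq_compProd (β' : ℝ)
    (κ : ℝ≥0 → Kernel (GaugeConfig 3 L (Matrix.specialUnitaryGroup (Fin 2) ℂ))
      (GaugeConfig 3 L (Matrix.specialUnitaryGroup (Fin 2) ℂ))) [∀ t, IsMarkovKernel (κ t)]
    (hreal : ∀ (t : ℝ≥0) (x : GaugeConfig 3 L (Matrix.specialUnitaryGroup (Fin 2) ℂ))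
        (Ω : Type) [MeasurableSpace Ω] (P : Measure Ω) [IsProbabilityMeasure P]
        (W : ℝ≥0 → Ω → (Edge 3 L × NoiseIdx 2 → ℝ)) (hW : IsFlatBrownian W P)
        (U : ℝ≥0 → Ω → GaugeConfig 3 L (Matrix.specialUnitaryGroup (Fin 2) ℂ)),
        (∀ ω, U 0 ω = x) →
        (latticeLangevinDynamics (fundamentalLatticeRep 2) β').IsSolution (fundamentalRep (Fin 2))
          hW.natFiltration P W U →
        κ t x = P.map (U t))
    (x : GaugeConfig 3 L (Matrix.specialUnitaryGroup (Fin 2) ℂ))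
    {Ω : Type} [MeasurableSpace Ω] {P : Measure Ω} [IsProbabilityMeasure P]
    {W : ℝ≥0 → Ω → (Edge 3 L × NoiseIdx 2 → ℝ)} (hW : IsFlatBrownian W P)
    {U : ℝ≥0 → Ω → GaugeConfig 3 L (Matrix.specialUnitaryGroup (Fin 2) ℂ)} (hU0 : ∀ ω, U 0 ω = x)
    (hU : (latticeLangevinDynamics (fundamentalLatticeRep 2) β').IsSolution (fundamentalRep (Fin 2)) hW.natFiltration P W U)
    (s t : ℝ≥0) :
    P.map (fun ω => (U s ω, U (s + t) ω)) = (κ s x) ⊗ₘ (κ t) := by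
  classical
  have hmU : ∀ u : ℝ≥0, Measurable (U u) := fun u => (hU.adapted u).mono (hW.natFiltration.le u) le_rfl
  have hpair : Measurable fun ω => (U s ω, U (s + t) ω) := (hmU s).prodMk (hmU (s + t))
  haveI : IsProbabilityMeasure (P.map fun ω => (U s ω, U (s + t) ω)) := Measure.isProbabilityMeasure_map hpair.aemeasurable
  have hκs : κ s x = P.map (U s) := hreal s x Ω P W hW U hU0 hU
  refine ext_of_generate_finite _ generateFrom_prod.symm isPiSystem_prod (fun S hS => ?_) (by rw [measure_univ, measure_univ])
  obtain ⟨A, hA, B, hB, rfl⟩ := hS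
  simp only [Set.mem_setOf_eq] at hA hB
  rw [Measure.map_apply hpair (hA.prod hB), Measure.compProd_apply_prod hA hB, hκs,
    setLIntegral_map hA ((κ t).measurable_coe hB) (hmU s)]
  -- the Markov property with `Z = 1_A(U_s)`, `G = 1_B`
  have hZ : Measurable[hW.natFiltration s] fun ω => A.indicator (fun _ => (1 : ℝ)) (U s ω) :=
    (measurable_const.indicator hA).comp (hU.adapted s)
  have hZb : ∀ ω, |A.indicator (fun _ => (1 : ℝ)) (U s ω)| ≤ 1 := fun ω => by by_cases h : U s ω ∈ A <;> simp [h]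
  have hGb : ∀ z, |B.indicator (fun _ => (1 : ℝ)) z| ≤ 1 := fun z => by by_cases h : z ∈ B <;> simp [h]
  have hM := integral_mul_comp_add_eq_integral_mul_transition β' κ hreal x hW hU0 hU s t hZ hZb (measurable_const.indicator hB) hGb
  -- left side of `hM` is `P(U_s ∈ A, U_(s+t) ∈ B)`
  have hL : ∫ ω, A.indicator (fun _ => (1 : ℝ)) (U s ω) * B.indicator (fun _ => (1 : ℝ)) (U (s + t) ω) ∂P =
      (P ((fun ω => (U s ω, U (s + t) ω)) ⁻¹' A ×ˢ B)).toReal := by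
    have hfun : (fun ω => A.indicator (fun _ => (1 : ℝ)) (U s ω) * B.indicator (fun _ => (1 : ℝ)) (U (s + t) ω)) =
        ((fun ω => (U s ω, U (s + t) ω)) ⁻¹' A ×ˢ B).indicator 1 := by
      funext ω
      by_cases hA' : U s ω ∈ A <;> by_cases hB' : U (s + t) ω ∈ B <;> simp [hA', hB', Set.indicator, Set.mem_prod]
    rw [hfun, integral_indicator_one (hpair (hA.prod hB))]
    rfl
  -- right side of `hM` is `∫_{U_s ∈ A} κ_t(U_s, B) dP`
  have hR : ∫ ω, A.indicator (fun _ => (1 : ℝ)) (U s ω) * (∫ z, B.indicator (fun _ => (1 : ℝ)) z ∂(κ t (U s ω))) ∂P =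
      (∫⁻ ω in U s ⁻¹' A, κ t (U s ω) B ∂P).toReal := by
    have hin : ∀ y, ∫ z, B.indicator (fun _ => (1 : ℝ)) z ∂(κ t y) = ((κ t y) B).toReal := fun y => by
      rw [show (B.indicator fun _ => (1 : ℝ)) = B.indicator 1 from rfl, integral_indicator_one hB]
      rfl
    simp_rw [hin]
    have hfun : (fun ω => A.indicator (fun _ => (1 : ℝ)) (U s ω) * ((κ t (U s ω)) B).toReal) =
        (U s ⁻¹' A).indicator (fun ω => ((κ t (U s ω)) B).toReal) := by
      funext ω
      by_cases hA' : U s ω ∈ A <;> simp [hA']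
    have hae : AEMeasurable (fun ω => κ t (U s ω) B) (P.restrict (U s ⁻¹' A)) :=
      (((κ t).measurable_coe hB).comp (hmU s)).aemeasurable
    rw [hfun, integral_indicator ((hmU s) hA), integral_toReal hae (Eventually.of_forall fun ω => measure_lt_top _ _)]
  have hfin : ∫⁻ ω in U s ⁻¹' A, κ t (U s ω) B ∂P ≠ ∞ := by
    refine ne_top_of_le_ne_top (measure_ne_top (P.restrict (U s ⁻¹' A)) Set.univ) ?_
    calc ∫⁻ ω in U s ⁻¹' A, κ t (U s ω) B ∂P ≤ ∫⁻ _ω in U s ⁻¹' A, 1 ∂P := lintegral_mono fun ω => prob_le_one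
      _ = _ := by rw [lintegral_const, one_mul]
  exact (ENNReal.toReal_eq_toReal_iff' (measure_ne_top _ _) hfin).1 (by rw [← hL, ← hR]; exact hM)

/-! ## §3. Two-time expectations through the kernels -/

/-- ★★★ **Two-time expectations, kernel form**: `∫ H(U_s, U_(s+t)) dP = ∫∫ H(y, z) κ_t(y, dz) κ_s(x, dy)` for every bounded measurable `H` on the
product of two copies of the configuration space and every strong solution from `x` on any space. [folklore] -/
theorem integral_pair_eq_integral_integral_transition (β' : ℝ)
    (κ : ℝ≥0 → Kernel (GaugeConfig 3 L (Matrix.specialUnitaryGroup (Fin 2) ℂ))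
      (GaugeConfig 3 L (Matrix.specialUnitaryGroup (Fin 2) ℂ))) [∀ t, IsMarkovKernel (κ t)]
    (hreal : ∀ (t : ℝ≥0) (x : GaugeConfig 3 L (Matrix.specialUnitaryGroup (Fin 2) ℂ))
        (Ω : Type) [MeasurableSpace Ω] (P : Measure Ω) [IsProbabilityMeasure P]
        (W : ℝ≥0 → Ω → (Edge 3 L × NoiseIdx 2 → ℝ)) (hW : IsFlatBrownian W P)
        (U : ℝ≥0 → Ω → GaugeConfig 3 L (Matrix.specialUnitaryGroup (Fin 2) ℂ)),
        (∀ ω, U 0 ω = x) →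
        (latticeLangevinDynamics (fundamentalLatticeRep 2) β').IsSolution (fundamentalRep (Fin 2))
          hW.natFiltration P W U →
        κ t x = P.map (U t))
    (x : GaugeConfig 3 L (Matrix.specialUnitaryGroup (Fin 2) ℂ))
    {Ω : Type} [MeasurableSpace Ω] {P : Measure Ω} [IsProbabilityMeasure P]
    {W : ℝ≥0 → Ω → (Edge 3 L × NoiseIdx 2 → ℝ)} (hW : IsFlatBrownian W P)
    {U : ℝ≥0 → Ω → GaugeConfig 3 L (Matrix.specialUnitaryGroup (Fin 2) ℂ)} (hU0 : ∀ ω, U 0 ω = x)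
    (hU : (latticeLangevinDynamics (fundamentalLatticeRep 2) β').IsSolution (fundamentalRep (Fin 2)) hW.natFiltration P W U)
    (s t : ℝ≥0) {H : GaugeConfig 3 L (Matrix.specialUnitaryGroup (Fin 2) ℂ) × GaugeConfig 3 L (Matrix.specialUnitaryGroup (Fin 2) ℂ) → ℝ}
    (hH : Measurable H) {CH : ℝ} (hHb : ∀ q, |H q| ≤ CH) :
    ∫ ω, H (U s ω, U (s + t) ω) ∂P = ∫ y, ∫ z, H (y, z) ∂(κ t y) ∂(κ s x) := by
  have hmU : ∀ u : ℝ≥0, Measurable (U u) := fun u => (hU.adapted u).mono (hW.natFiltration.le u) le_rfl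
  have hpair : Measurable fun ω => (U s ω, U (s + t) ω) := (hmU s).prodMk (hmU (s + t))
  have hint : Integrable H ((κ s x) ⊗ₘ (κ t)) :=
    (integrable_const CH).mono' hH.aestronglyMeasurable (Eventually.of_forall fun q => by simpa [Real.norm_eq_abs] using hHb q)
  calc ∫ ω, H (U s ω, U (s + t) ω) ∂P = ∫ q, H q ∂(P.map fun ω => (U s ω, U (s + t) ω)) :=
        (integral_map hpair.aemeasurable hH.aestronglyMeasurable).symm
    _ = ∫ q, H q ∂((κ s x) ⊗ₘ (κ t)) := by rw [map_pair_eq_compProd β' κ hreal x hW hU0 hU s t]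
    _ = ∫ y, ∫ z, H (y, z) ∂(κ t y) ∂(κ s x) := Measure.integral_compProd hint

/-- ★★★ **Two-time expectations, solution form**: `∫ H(U_s, U_(s+t)) dP = ∫ (∫ H(U_s, z) κ_t(U_s, dz)) dP` for every bounded measurable `H`
and every strong solution from a deterministic start on any space. [folklore] -/
theorem integral_pair_eq_integral_transition (β' : ℝ)
    (κ : ℝ≥0 → Kernel (GaugeConfig 3 L (Matrix.specialUnitaryGroup (Fin 2) ℂ))
      (GaugeConfig 3 L (Matrix.specialUnitaryGroup (Fin 2) ℂ))) [∀ t, IsMarkovKernel (κ t)]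
    (hreal : ∀ (t : ℝ≥0) (x : GaugeConfig 3 L (Matrix.specialUnitaryGroup (Fin 2) ℂ))
        (Ω : Type) [MeasurableSpace Ω] (P : Measure Ω) [IsProbabilityMeasure P]
        (W : ℝ≥0 → Ω → (Edge 3 L × NoiseIdx 2 → ℝ)) (hW : IsFlatBrownian W P)
        (U : ℝ≥0 → Ω → GaugeConfig 3 L (Matrix.specialUnitaryGroup (Fin 2) ℂ)),
        (∀ ω, U 0 ω = x) →
        (latticeLangevinDynamics (fundamentalLatticeRep 2) β').IsSolution (fundamentalRep (Fin 2))
          hW.natFiltration P W U →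
        κ t x = P.map (U t))
    (x : GaugeConfig 3 L (Matrix.specialUnitaryGroup (Fin 2) ℂ))
    {Ω : Type} [MeasurableSpace Ω] {P : Measure Ω} [IsProbabilityMeasure P]
    {W : ℝ≥0 → Ω → (Edge 3 L × NoiseIdx 2 → ℝ)} (hW : IsFlatBrownian W P)
    {U : ℝ≥0 → Ω → GaugeConfig 3 L (Matrix.specialUnitaryGroup (Fin 2) ℂ)} (hU0 : ∀ ω, U 0 ω = x)
    (hU : (latticeLangevinDynamics (fundamentalLatticeRep 2) β').IsSolution (fundamentalRep (Fin 2)) hW.natFiltration P W U)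
    (s t : ℝ≥0) {H : GaugeConfig 3 L (Matrix.specialUnitaryGroup (Fin 2) ℂ) × GaugeConfig 3 L (Matrix.specialUnitaryGroup (Fin 2) ℂ) → ℝ}
    (hH : Measurable H) {CH : ℝ} (hHb : ∀ q, |H q| ≤ CH) :
    ∫ ω, H (U s ω, U (s + t) ω) ∂P = ∫ ω, ∫ z, H (U s ω, z) ∂(κ t (U s ω)) ∂P := by
  have hmU : ∀ u : ℝ≥0, Measurable (U u) := fun u => (hU.adapted u).mono (hW.natFiltration.le u) le_rfl
  have hκs : κ s x = P.map (U s) := hreal s x Ω P W hW U hU0 hU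
  rw [integral_pair_eq_integral_integral_transition β' κ hreal x hW hU0 hU s t hH hHb, hκs,
    integral_map (hmU s).aemeasurable]
  exact (hH.stronglyMeasurable.integral_kernel_prod_right' (κ := κ t)).aestronglyMeasurable

/-- ★ **The two-time correlation function through the semigroup**: `E[F(U_s)·G(U_(s+t))] = ∫ F·(κ_t G) dκ_s(x)` for bounded measurable `F, G`
and every strong solution from `x` on any space — the solution form of the quantity bounded by the kernel-form space-time light cone
(`LiebRobinson.transition_twoTime_covariance_abs_le_lightCone_of_separated`). [folklore] -/
theorem integral_mul_comp_add_eq_transition (β' : ℝ)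
    (κ : ℝ≥0 → Kernel (GaugeConfig 3 L (Matrix.specialUnitaryGroup (Fin 2) ℂ))
      (GaugeConfig 3 L (Matrix.specialUnitaryGroup (Fin 2) ℂ))) [∀ t, IsMarkovKernel (κ t)]
    (hreal : ∀ (t : ℝ≥0) (x : GaugeConfig 3 L (Matrix.specialUnitaryGroup (Fin 2) ℂ))
        (Ω : Type) [MeasurableSpace Ω] (P : Measure Ω) [IsProbabilityMeasure P]
        (W : ℝ≥0 → Ω → (Edge 3 L × NoiseIdx 2 → ℝ)) (hW : IsFlatBrownian W P)
        (U : ℝ≥0 → Ω → GaugeConfig 3 L (Matrix.specialUnitaryGroup (Fin 2) ℂ)),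
        (∀ ω, U 0 ω = x) →
        (latticeLangevinDynamics (fundamentalLatticeRep 2) β').IsSolution (fundamentalRep (Fin 2))
          hW.natFiltration P W U →
        κ t x = P.map (U t))
    (x : GaugeConfig 3 L (Matrix.specialUnitaryGroup (Fin 2) ℂ))
    {Ω : Type} [MeasurableSpace Ω] {P : Measure Ω} [IsProbabilityMeasure P]
    {W : ℝ≥0 → Ω → (Edge 3 L × NoiseIdx 2 → ℝ)} (hW : IsFlatBrownian W P)
    {U : ℝ≥0 → Ω → GaugeConfig 3 L (Matrix.specialUnitaryGroup (Fin 2) ℂ)} (hU0 : ∀ ω, U 0 ω = x)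
    (hU : (latticeLangevinDynamics (fundamentalLatticeRep 2) β').IsSolution (fundamentalRep (Fin 2)) hW.natFiltration P W U)
    (s t : ℝ≥0) {F : GaugeConfig 3 L (Matrix.specialUnitaryGroup (Fin 2) ℂ) → ℝ} (hF : Measurable F) {CF : ℝ} (hFb : ∀ z, |F z| ≤ CF)
    {G : GaugeConfig 3 L (Matrix.specialUnitaryGroup (Fin 2) ℂ) → ℝ} (hG : Measurable G) {CG : ℝ} (hGb : ∀ z, |G z| ≤ CG) :
    ∫ ω, F (U s ω) * G (U (s + t) ω) ∂P = ∫ y, F y * (∫ z, G z ∂(κ t y)) ∂(κ s x) := by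
  have hmU : ∀ u : ℝ≥0, Measurable (U u) := fun u => (hU.adapted u).mono (hW.natFiltration.le u) le_rfl
  have hκs : κ s x = P.map (U s) := hreal s x Ω P W hW U hU0 hU
  have hZ : Measurable[hW.natFiltration s] fun ω => F (U s ω) := hF.comp (hU.adapted s)
  have hκGm : Measurable fun y => ∫ z, G z ∂(κ t y) := (hG.stronglyMeasurable.integral_kernel (κ := κ t)).measurable
  rw [integral_mul_comp_add_eq_integral_mul_transition β' κ hreal x hW hU0 hU s t hZ (fun ω => hFb _) hG hGb, hκs,
    integral_map (hmU s).aemeasurable]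
  exact (hF.mul hκGm).aestronglyMeasurable

/-- **The Markov property with the transition operator along any realisation**: for every jointly measurable solution family `V` on any
(other) probability space, `∫ Z·G(U_(s+t)) dP = ∫ Z·(markovTransition V P₂ t G)(U_s) dP` (`𝓕^W_s`-measurable bounded `Z`, bounded measurable
`G`) — the `Z`-weighted form of `integral_add_eq_integral_markovTransition`. [cite: ShenZhuZhu2022, §3 (after Lemma 3.3, p. 13)] -/
theorem integral_mul_comp_add_eq_integral_mul_markovTransition (β' : ℝ)
    (x : GaugeConfig 3 L (Matrix.specialUnitaryGroup (Fin 2) ℂ))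
    {Ω : Type} [MeasurableSpace Ω] {P : Measure Ω} [IsProbabilityMeasure P]
    {W : ℝ≥0 → Ω → (Edge 3 L × NoiseIdx 2 → ℝ)} (hW : IsFlatBrownian W P)
    {U : ℝ≥0 → Ω → GaugeConfig 3 L (Matrix.specialUnitaryGroup (Fin 2) ℂ)} (hU0 : ∀ ω, U 0 ω = x)
    (hU : (latticeLangevinDynamics (fundamentalLatticeRep 2) β').IsSolution (fundamentalRep (Fin 2)) hW.natFiltration P W U)
    {Ω₂ : Type} [MeasurableSpace Ω₂] {P₂ : Measure Ω₂} [IsProbabilityMeasure P₂]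
    {W₂ : ℝ≥0 → Ω₂ → (Edge 3 L × NoiseIdx 2 → ℝ)} (hW₂ : IsFlatBrownian W₂ P₂)
    (V : GaugeConfig 3 L (Matrix.specialUnitaryGroup (Fin 2) ℂ) → ℝ≥0 → Ω₂ →
      GaugeConfig 3 L (Matrix.specialUnitaryGroup (Fin 2) ℂ))
    (hV : ∀ y, (∀ ω, V y 0 ω = y) ∧
      (latticeLangevinDynamics (fundamentalLatticeRep 2) β').IsSolution (fundamentalRep (Fin 2)) hW₂.natFiltration P₂ W₂ (V y))
    (hVm : ∀ t : ℝ≥0, Measurable fun p : GaugeConfig 3 L (Matrix.specialUnitaryGroup (Fin 2) ℂ) × Ω₂ => V p.1 t p.2)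
    (s t : ℝ≥0) {Z : Ω → ℝ} (hZ : Measurable[hW.natFiltration s] Z) {CZ : ℝ} (hZb : ∀ ω, |Z ω| ≤ CZ)
    {G : GaugeConfig 3 L (Matrix.specialUnitaryGroup (Fin 2) ℂ) → ℝ} (hG : Measurable G) {CG : ℝ} (hGb : ∀ z, |G z| ≤ CG) :
    ∫ ω, Z ω * G (U (s + t) ω) ∂P = ∫ ω, Z ω * markovTransition V P₂ t G (U s ω) ∂P := by
  classical
  obtain ⟨κ, hκM, -, hreal⟩ := exists_transitionKernel L β'
  haveI := hκM
  have hVx : ∀ y, Measurable (V y t) := fun y => (hVm t).comp measurable_prodMk_left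
  have hrep : markovTransition V P₂ t G = fun y => ∫ z, G z ∂(κ t y) := by
    funext y
    rw [hreal t y Ω₂ P₂ W₂ hW₂ (V y) (hV y).1 (hV y).2, integral_map (hVx y).aemeasurable hG.aestronglyMeasurable]
    rfl
  rw [hrep]
  exact integral_mul_comp_add_eq_integral_mul_transition β' κ hreal x hW hU0 hU s t hZ hZb hG hGb

end Summit.QuantumFields.YangMills.Theorems.ColdStartUniversality

end
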